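import Summits.HodgeConjecture.CorCM.GenericCMSubfieldTowerTypes
import Literature.AlgebraicGeometry.Pohlmann1968.SeparatingCMFamilies
import Literature.AlgebraicGeometry.Pohlmann1968.SimpleCMAbelianVarietyPowersDivisorGenerated
import HarnessLib

/-!
# A generic CM field INSIDE the CM field of the partner, II (abelian varieties): the Hodge conjecture on every
# `A₀^a × A₁^b` unless the partner's type has constant unequal multiplicities — and the CM elliptic curve reading

COR-CM (cell `pub-hodgecm2`, binder seat `b16` gen 52, count-neutral claim TOWER-SHADOW, file F4 — abelian varieties and
the supply of relative pair flips; theorems only, no definition, no named fact, no `sorry`).  NEW as stated, hence under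
`Summits/`.  HONEST FRAMING: unconditional «HC for NAMED classes» / «exceptional classes for NAMED classes» statements;
`HC_CM` is neither used nor asserted; exceptional classes are not claimed algebraic or non-algebraic.

SETTING of F3 `GenericCMSubfieldTowerTypes`: `I = {i₀, i₁}`, `j : K_{i₀} → K_{i₁}`, relative pair flips (RPF), realisations
`(A_i, ι_i, θ_i)` of the types `Φ_i`; multiplicities `n(x) = #{y ∈ Φ₁ | y ∘ j = x}`.

* §1 ABELIAN VARIETIES: **`hodgeConjectureFor_prod_of_relPairFlip`** — the Hodge conjecture with `B• = D•` on every
  `A₀^a × A₁^b` (every `⨁_{j<N} A_{π j}`) when `Φ₁` is nondegenerate and NOT of constant unequal multiplicities over `Φ₀`,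
  UNCONDITIONALLY; `hodgeConjectureFor_prod_of_relPairFlip_of_quadratic` (quadratic steps: `Φ₁` nondegenerate suffices);
  **`exists_exceptional_prod_of_multiplicities_self`** — constant unequal multiplicities put an exceptional Hodge class on
  some `A₀^a × A₁^b` for simple non-isogenous realisations, even when `A₁` is nondegenerate (no flip hypothesis);
  **`forall_prod_hodgeClassSpan_eq_iff_of_relPairFlip`** — simple non-isogenous realisations: `B• = D•` on ALL products IFF
  the criterion.
* §2 SUPPLY of (RPF): `relPairFlip_of_pairFlip_fix` (pair flips of `K_{i₀}` fixing the embeddings of a field `F₁` which,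
  with `K_{i₀}`, determines the embeddings of `K_{i₁}` — e.g. `K_{i₁} = K_{i₀}·F₁`), `relPairFlip_of_finrank_eq_two` (an
  imaginary quadratic base: automatic), and the classical reading **`cmFamilyRank_add_card_eq_iff_balanced_of_finrank_eq_two`**:
  `E` a CM elliptic curve with `k = End⁰(E) → K₁ = End⁰(A₁)`: `Hg(E × A₁) = Hg(E) × Hg(A₁)` IFF the `k`-signature of `Φ₁`
  is BALANCED at every place (else `MT(E × A₁) → MT(A₁)` is an isogeny, F3 `cmFamilyRank_eq_cmTypeRank_of_multiplicities`;
  Moonen–Zarhin's case `k ↪ End⁰(X₂)`).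

## References

* [Gordon1999HodgeAVSurvey] B. B. Gordon, *A survey of the Hodge conjecture for abelian varieties*, 7.4–7.7 (Murty,
  Hazama), 9.4.3 (Yanai), 10.10.
* [MoonenZarhin1999LowDim] B. Moonen, Yu. Zarhin, *Hodge classes on abelian varieties of low dimension*, Math. Ann.
  315 (1999), Thm. (0.2).
* [Kubota1965] T. Kubota, *On the field extension by complex multiplication*, Trans. AMS 118 (1965), §2.
* [Shimura1998] G. Shimura, *Abelian Varieties with Complex Multiplication and Modular Functions*, §8.2 Prop. 26.
-/

noncomputable section

open CategoryTheory CategoryTheory.Limits NumberField Module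

namespace Summit.HodgeConjecture.CorCM

open Literature.NumberTheory.ComplexMultiplication
open Literature.AlgebraicGeometry.Motives (AbelianVariety CMType)
open Literature.AlgebraicGeometry.HodgeTheory
open Literature.AlgebraicGeometry.ComplexMultiplication (IsCMTypeRealisation)
open Literature.AlgebraicGeometry.VanGeemen1994 (hodgeClassSpan)
open Literature.AlgebraicGeometry.Pohlmann1968
open Literature.Barriers.HodgeConjecture (divisorClassesSpan)
open scoped Classical

variable {I : Type} {K : I → Type} [∀ i, Field (K i)] [∀ i, NumberField (K i)] [∀ i, IsCMField (K i)] [Fintype I]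
  [DecidableEq I] {Φ : ∀ i, CMType (K i)} {i₀ i₁ : I}

/-! ### §1 On abelian varieties: the Hodge conjecture on the products, or an exceptional class -/

section Varieties

variable {A : I → AbelianVariety ℂ} {ι : ∀ i, 𝓞 (K i) →+* End (A i)}
  {θ : ∀ i, K i →+* Module.End ℂ (complexBetti (A i).X 1)}

/-- **The Hodge conjecture on every `A₀^a × A₁^b`** (every `⨁_{j<N} A_{π j}`), with `B• = D•` there, for realisations of a
pair with `j : K_{i₀} → K_{i₁}` and relative pair flips, when `Φ₁` is nondegenerate and NOT of constant unequal
multiplicities over `Φ₀` — UNCONDITIONALLY (nondegenerate families satisfy the Hodge conjecture on all products).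
[cite: Gordon1999HodgeAVSurvey, 7.5 and 10.10] -/
theorem hodgeConjectureFor_prod_of_relPairFlip [Nonempty I] (hI : ∀ i, i = i₀ ∨ i = i₁) (h01 : i₀ ≠ i₁)
    (j : K i₀ →+* K i₁)
    (hflip : ∀ x : K i₀ →+* ℂ, ∃ σ : ℂ ≃+* ℂ, σ • x = (starRingAut : ℂ ≃+* ℂ) • x ∧
      ∀ y : K i₁ →+* ℂ, y.comp j ≠ x → y.comp j ≠ (starRingAut : ℂ ≃+* ℂ) • x → σ • y = y)
    (hnd : IsNondegenerate (Φ i₁))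
    (hnot : ¬ ∃ a b : ℕ, a ≠ b ∧ ∀ x : K i₀ →+* ℂ,
      (Finset.univ.filter fun y : K i₁ →+* ℂ => y.comp j = x ∧ y ∈ (Φ i₁).1).card = if x ∈ (Φ i₀).1 then a else b)
    (hA : ∀ i, IsCMTypeRealisation (Φ i) (A i) (ι i) (θ i)) {N : ℕ} (π : Fin N → I) :
    HodgeConjectureFor (⨁ fun j : Fin N => A (π j)).dim (⨁ fun j : Fin N => A (π j)).X ∧
      ∀ m : ℕ, hodgeClassSpan (⨁ fun j : Fin N => A (π j)).dim (⨁ fun j : Fin N => A (π j)).X m =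
        divisorClassesSpan (⨁ fun j : Fin N => A (π j)).X (⨁ fun j : Fin N => A (π j)).dim m :=
  have h := (isNondegenerateFamily_iff_of_relPairFlip hI h01 j hflip).2 ⟨hnd, hnot⟩
  ⟨h.hodgeConjectureFor_prod hA π, fun m => h.hodgeClassSpan_prod_eq_divisorClassesSpan hA π m⟩

/-- **The quadratic case on abelian varieties**: `[K_{i₁} : ℚ] = 2 [K_{i₀} : ℚ]`, relative pair flips, `Φ₁` nondegenerate
⟹ the Hodge conjecture with `B• = D•` on every `A₀^a × A₁^b`, UNCONDITIONALLY — e.g. a generic CM threefold times a CM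
sixfold whose field is a relative-pair-flip quadratic extension of the sextic field and whose type is nondegenerate.
[cite: Gordon1999HodgeAVSurvey, 7.5 and 10.10] [cite: Kubota1965, §2 Lemma 2] -/
theorem hodgeConjectureFor_prod_of_relPairFlip_of_quadratic [Nonempty I] (hI : ∀ i, i = i₀ ∨ i = i₁) (h01 : i₀ ≠ i₁)
    (j : K i₀ →+* K i₁) (hdeg : finrank ℚ (K i₁) = 2 * finrank ℚ (K i₀))
    (hflip : ∀ x : K i₀ →+* ℂ, ∃ σ : ℂ ≃+* ℂ, σ • x = (starRingAut : ℂ ≃+* ℂ) • x ∧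
      ∀ y : K i₁ →+* ℂ, y.comp j ≠ x → y.comp j ≠ (starRingAut : ℂ ≃+* ℂ) • x → σ • y = y)
    (hnd : IsNondegenerate (Φ i₁)) (hA : ∀ i, IsCMTypeRealisation (Φ i) (A i) (ι i) (θ i)) {N : ℕ}
    (π : Fin N → I) :
    HodgeConjectureFor (⨁ fun j : Fin N => A (π j)).dim (⨁ fun j : Fin N => A (π j)).X ∧
      ∀ m : ℕ, hodgeClassSpan (⨁ fun j : Fin N => A (π j)).dim (⨁ fun j : Fin N => A (π j)).X m =
        divisorClassesSpan (⨁ fun j : Fin N => A (π j)).X (⨁ fun j : Fin N => A (π j)).dim m :=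
  have h := (isNondegenerateFamily_iff_of_relPairFlip_of_quadratic hI h01 j hdeg hflip).2 hnd
  ⟨h.hodgeConjectureFor_prod hA π, fun m => h.hodgeClassSpan_prod_eq_divisorClassesSpan hA π m⟩

/-- **Dimension reading of the quadratic case**: realisations with `dim A₁ = 2 · dim A₀`, `j : K_{i₀} → K_{i₁}` with
relative pair flips, `Φ₁` nondegenerate ⟹ the Hodge conjecture with `B• = D•` on every `A₀^a × A₁^b`, UNCONDITIONALLY (e.g. a
generic CM surface times a CM fourfold, a generic CM threefold times a CM sixfold, through a relative-pair-flip quadratic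
step of the fields). [cite: Gordon1999HodgeAVSurvey, 7.5 and 10.10] [cite: Shimura1998, §5.2] -/
theorem hodgeConjectureFor_prod_of_relPairFlip_of_dim_eq_two_mul [Nonempty I] (hI : ∀ i, i = i₀ ∨ i = i₁)
    (h01 : i₀ ≠ i₁) (j : K i₀ →+* K i₁)
    (hflip : ∀ x : K i₀ →+* ℂ, ∃ σ : ℂ ≃+* ℂ, σ • x = (starRingAut : ℂ ≃+* ℂ) • x ∧
      ∀ y : K i₁ →+* ℂ, y.comp j ≠ x → y.comp j ≠ (starRingAut : ℂ ≃+* ℂ) • x → σ • y = y)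
    (hA : ∀ i, IsCMTypeRealisation (Φ i) (A i) (ι i) (θ i)) (hdim : (A i₁).dim = 2 * (A i₀).dim)
    (hnd : IsNondegenerate (Φ i₁)) {N : ℕ} (π : Fin N → I) :
    HodgeConjectureFor (⨁ fun j : Fin N => A (π j)).dim (⨁ fun j : Fin N => A (π j)).X ∧
      ∀ m : ℕ, hodgeClassSpan (⨁ fun j : Fin N => A (π j)).dim (⨁ fun j : Fin N => A (π j)).X m =
        divisorClassesSpan (⨁ fun j : Fin N => A (π j)).X (⨁ fun j : Fin N => A (π j)).dim m := by
  have hdeg : finrank ℚ (K i₁) = 2 * finrank ℚ (K i₀) := by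
    rw [finrank_eq_two_mul_dim_of_isCMTypeRealisation (hA i₁), finrank_eq_two_mul_dim_of_isCMTypeRealisation (hA i₀),
      hdim]
  exact hodgeConjectureFor_prod_of_relPairFlip_of_quadratic hI h01 j hdeg hflip hnd hA π

omit [DecidableEq I] in
/-- **Constant unequal multiplicities ⟹ an exceptional Hodge class** on some `A₀^a × A₁^b` for realisations with `A_{i₁}`
SIMPLE (then `Φ₁` is primitive and, the degrees being different whenever `[K_{i₁} : K_{i₀}] ≥ 2`, the pair is separating as
soon as `A₀ ≁ A₁`) — even when `A_{i₁}` is nondegenerate; no flip hypothesis.  A rational `(m,m)`-class outside `Dᵐ ⊗ ℂ`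
(not claimed algebraic or not). [cite: Gordon1999HodgeAVSurvey, 7.4–7.6.1 and 9.4.3] -/
theorem exists_exceptional_prod_of_multiplicities_self [Nonempty I] (h01 : i₀ ≠ i₁) (j : K i₀ →+* K i₁) {a b : ℕ}
    (hmult : ∀ x : K i₀ →+* ℂ, (Finset.univ.filter fun y : K i₁ →+* ℂ => y.comp j = x ∧ y ∈ (Φ i₁).1).card =
      if x ∈ (Φ i₀).1 then a else b) (hab : a ≠ b) (hA : ∀ i, IsCMTypeRealisation (Φ i) (A i) (ι i) (θ i))
    (hs : ∀ i, (A i).IsSimple) (hniso : ∀ i i', i ≠ i' → ¬ AbelianVariety.IsIsogenous (A i) (A i')) :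
    ∃ (N : ℕ) (π : Fin N → I) (m : ℕ) (c : complexBetti (⨁ fun j : Fin N => A (π j)).X (2 * m)),
      IsRationalClass c ∧
      IsOfHodgeType (⨁ fun j : Fin N => A (π j)).dim (⨁ fun j : Fin N => A (π j)).X (2 * m) m m c ∧
      c ∉ divisorClassesSpan (⨁ fun j : Fin N => A (π j)).X (⨁ fun j : Fin N => A (π j)).dim m :=
  CMAlgebra.exists_exceptional_prod_of_not_isNondegenerateFamily
    (CMAlgebra.isSeparatingFamily_of_isSimple_of_pairwise_not_isIsogenous hA hs hniso)
    (not_isNondegenerateFamily_of_cmFamilyRank_add_card_lt Φ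
      (cmFamilyRank_add_card_lt_of_multiplicities_self h01 j hmult hab)) hA

/-- **For SIMPLE, NON-ISOGENOUS realisations: `B• = D•` on ALL products `A₀^a × A₁^b` IFF the criterion holds** (`Φ₁`
nondegenerate and not of constant unequal multiplicities over `Φ₀`); otherwise some product carries an exceptional class.
[cite: Gordon1999HodgeAVSurvey, 7.5 and 7.6.1] -/
theorem forall_prod_hodgeClassSpan_eq_iff_of_relPairFlip [Nonempty I] (hI : ∀ i, i = i₀ ∨ i = i₁) (h01 : i₀ ≠ i₁)
    (j : K i₀ →+* K i₁)
    (hflip : ∀ x : K i₀ →+* ℂ, ∃ σ : ℂ ≃+* ℂ, σ • x = (starRingAut : ℂ ≃+* ℂ) • x ∧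
      ∀ y : K i₁ →+* ℂ, y.comp j ≠ x → y.comp j ≠ (starRingAut : ℂ ≃+* ℂ) • x → σ • y = y)
    (hA : ∀ i, IsCMTypeRealisation (Φ i) (A i) (ι i) (θ i)) (hs : ∀ i, (A i).IsSimple)
    (hniso : ∀ i i', i ≠ i' → ¬ AbelianVariety.IsIsogenous (A i) (A i')) :
    (∀ (N : ℕ) (π : Fin N → I) (m : ℕ),
      hodgeClassSpan (⨁ fun j : Fin N => A (π j)).dim (⨁ fun j : Fin N => A (π j)).X m =
        divisorClassesSpan (⨁ fun j : Fin N => A (π j)).X (⨁ fun j : Fin N => A (π j)).dim m) ↔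
      IsNondegenerate (Φ i₁) ∧ ¬ ∃ a b : ℕ, a ≠ b ∧ ∀ x : K i₀ →+* ℂ,
        (Finset.univ.filter fun y : K i₁ →+* ℂ => y.comp j = x ∧ y ∈ (Φ i₁).1).card =
          if x ∈ (Φ i₀).1 then a else b := by
  rw [← CMAlgebra.isNondegenerateFamily_iff_forall_prod_hodgeClassSpan_eq
    (CMAlgebra.isSeparatingFamily_of_isSimple_of_pairwise_not_isIsogenous hA hs hniso) hA]
  exact isNondegenerateFamily_iff_of_relPairFlip hI h01 j hflip

end Varieties

/-! ### §2 Supply of relative pair flips; the imaginary quadratic base -/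

section Supply

omit [∀ i, NumberField (K i)] [∀ i, IsCMField (K i)] [Fintype I] [DecidableEq I] in
/-- **Relative pair flips from pair flips fixing a cofactor.**  If `K_{i₁}` receives a field `F₁` (`e₁ : F₁ → K_{i₁}`) such
that an embedding of `K_{i₁}` is determined by its restrictions along `j` and `e₁` (e.g. `K_{i₁} = K_{i₀} · F₁`), and the
pair flips of `K_{i₀}` can be taken to FIX every embedding of `F₁`, then they are relative pair flips. [folklore] -/
theorem relPairFlip_of_pairFlip_fix (j : K i₀ →+* K i₁) {F₁ : Type} [Field F₁] (e₁ : F₁ →+* K i₁)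
    (hdet : ∀ y y' : K i₁ →+* ℂ, y.comp j = y'.comp j → y.comp e₁ = y'.comp e₁ → y = y')
    (hflip : ∀ x : K i₀ →+* ℂ, ∃ σ : ℂ ≃+* ℂ, σ • x = (starRingAut : ℂ ≃+* ℂ) • x ∧
      (∀ x' : K i₀ →+* ℂ, x' ≠ x → x' ≠ (starRingAut : ℂ ≃+* ℂ) • x → σ • x' = x') ∧
      ∀ z : F₁ →+* ℂ, σ • z = z) (x : K i₀ →+* ℂ) :
    ∃ σ : ℂ ≃+* ℂ, σ • x = (starRingAut : ℂ ≃+* ℂ) • x ∧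
      ∀ y : K i₁ →+* ℂ, y.comp j ≠ x → y.comp j ≠ (starRingAut : ℂ ≃+* ℂ) • x → σ • y = y := by
  obtain ⟨σ, hσx, hσ, hσF⟩ := hflip x
  refine ⟨σ, hσx, fun y h1 h2 => hdet _ _ ?_ ?_⟩
  · rw [smul_comp_ringHom, hσ _ h1 h2]
  · rw [smul_comp_ringHom, hσF]

omit [∀ i, NumberField (K i)] [∀ i, IsCMField (K i)] [Fintype I] [DecidableEq I] in
/-- **Embeddings of a compositum are determined on the generators**: if `K_{i₁}` is generated as a field by `j(K_{i₀})` and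
`e₁(F₁)`, two complex embeddings of `K_{i₁}` agreeing after composition with `j` and with `e₁` are equal. [folklore] -/
theorem ringHom_eq_of_comp_eq_of_closure_eq_top (j : K i₀ →+* K i₁) {F₁ : Type} [Field F₁] (e₁ : F₁ →+* K i₁)
    (hgen : Subfield.closure (Set.range j ∪ Set.range e₁) = ⊤) (y y' : K i₁ →+* ℂ) (hj : y.comp j = y'.comp j)
    (he : y.comp e₁ = y'.comp e₁) : y = y' :=
  RingHom.eq_of_eqOn_of_field_closure_eq_top hgen fun a ha => by
    rcases ha with ⟨b, rfl⟩ | ⟨c, rfl⟩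
    · exact RingHom.congr_fun hj b
    · exact RingHom.congr_fun he c

omit [∀ i, NumberField (K i)] [∀ i, IsCMField (K i)] [Fintype I] [DecidableEq I] in
/-- **Relative pair flips for a compositum `K_{i₁} = K_{i₀} · F₁`**: if `K_{i₁}` is generated by `j(K_{i₀})` and `e₁(F₁)`
and the pair flips of `K_{i₀}` can be taken to fix every complex embedding of `F₁` (e.g. `F₁` totally real with Galois
closure linearly disjoint from that of `K_{i₀}` over that of `K_{i₀}⁺`), then (RPF) holds. [folklore] -/
theorem relPairFlip_of_pairFlip_fix_of_closure_eq_top (j : K i₀ →+* K i₁) {F₁ : Type} [Field F₁] (e₁ : F₁ →+* K i₁)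
    (hgen : Subfield.closure (Set.range j ∪ Set.range e₁) = ⊤)
    (hflip : ∀ x : K i₀ →+* ℂ, ∃ σ : ℂ ≃+* ℂ, σ • x = (starRingAut : ℂ ≃+* ℂ) • x ∧
      (∀ x' : K i₀ →+* ℂ, x' ≠ x → x' ≠ (starRingAut : ℂ ≃+* ℂ) • x → σ • x' = x') ∧
      ∀ z : F₁ →+* ℂ, σ • z = z) (x : K i₀ →+* ℂ) :
    ∃ σ : ℂ ≃+* ℂ, σ • x = (starRingAut : ℂ ≃+* ℂ) • x ∧
      ∀ y : K i₁ →+* ℂ, y.comp j ≠ x → y.comp j ≠ (starRingAut : ℂ ≃+* ℂ) • x → σ • y = y :=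
  relPairFlip_of_pairFlip_fix j e₁ (ringHom_eq_of_comp_eq_of_closure_eq_top j e₁ hgen) hflip x

omit [Fintype I] [DecidableEq I] in
/-- **An imaginary quadratic base has relative pair flips automatically** (complex conjugation itself: there is no
embedding off the two fibres). [folklore] -/
theorem relPairFlip_of_finrank_eq_two (j : K i₀ →+* K i₁) (h2 : finrank ℚ (K i₀) = 2) (x : K i₀ →+* ℂ) :
    ∃ σ : ℂ ≃+* ℂ, σ • x = (starRingAut : ℂ ≃+* ℂ) • x ∧
      ∀ y : K i₁ →+* ℂ, y.comp j ≠ x → y.comp j ≠ (starRingAut : ℂ ≃+* ℂ) • x → σ • y = y := by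
  refine ⟨starRingAut, rfl, fun y h1 h1' => ?_⟩
  exfalso
  have hne : (starRingAut : ℂ ≃+* ℂ) • x ≠ x := fun h => by
    rw [conj_smul_eq_conjugate] at h
    exact IsTotallyComplex.complexEmbedding_not_isReal x (ComplexEmbedding.isReal_iff.2 h)
  have hcard : Fintype.card (K i₀ →+* ℂ) = 2 := by rw [Embeddings.card, h2]
  have huniv : (Finset.univ : Finset (K i₀ →+* ℂ)) = {x, (starRingAut : ℂ ≃+* ℂ) • x} := by
    symm
    apply Finset.eq_univ_of_card
    rw [Finset.card_pair hne.symm, hcard]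
  have hmem : y.comp j ∈ ({x, (starRingAut : ℂ ≃+* ℂ) • x} : Finset (K i₀ →+* ℂ)) := huniv ▸ Finset.mem_univ _
  simp only [Finset.mem_insert, Finset.mem_singleton] at hmem
  rcases hmem with h | h
  · exact h1 h
  · exact h1' h

/-- **THE CLASSICAL READING: a CM elliptic curve against `A₁` with `k = End⁰(E) ⊆ End⁰(A₁)`.**  `[K_{i₀} : ℚ] = 2`,
`j : K_{i₀} → K_{i₁}`: `rank(Φ₀, Φ₁) + 2 = rank Φ₀ + rank Φ₁ + 1` (`Hg(E × A₁) = Hg(E) × Hg(A₁)`) IFF the `k`-SIGNATURE of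
`Φ₁` is BALANCED (`2 · #{y ∈ Φ₁ | y|_k = x} = [K_{i₁} : k]` at every place `x`); for an unbalanced signature
`MT(E × A₁) → MT(A₁)` is an isogeny (`cmFamilyRank_eq_cmTypeRank_of_multiplicities`).
[cite: MoonenZarhin1999LowDim, Thm. (0.2)] [cite: Gordon1999HodgeAVSurvey, §3 Theorem and 9.4.3] -/
theorem cmFamilyRank_add_card_eq_iff_balanced_of_finrank_eq_two (hI : ∀ i, i = i₀ ∨ i = i₁) (h01 : i₀ ≠ i₁)
    (j : K i₀ →+* K i₁) (h2 : finrank ℚ (K i₀) = 2) :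
    CMAlgebra.cmFamilyRank Φ + Fintype.card I = (∑ i, cmTypeRank (Φ i)) + 1 ↔
      ∀ x : K i₀ →+* ℂ, 2 * (Finset.univ.filter fun y : K i₁ →+* ℂ => y.comp j = x ∧ y ∈ (Φ i₁).1).card =
        (Finset.univ.filter fun y : K i₁ →+* ℂ => y.comp j = x).card := by
  rw [cmFamilyRank_add_card_eq_iff_of_relPairFlip hI h01 j (relPairFlip_of_finrank_eq_two j h2)]
  -- the two places `x₁ ∈ Φ₀`, `x̄₁ ∉ Φ₀`
  obtain ⟨x'⟩ : Nonempty (K i₀ →+* ℂ) := inferInstance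
  obtain ⟨x₁, hx₁⟩ : ∃ x₁ : K i₀ →+* ℂ, x₁ ∈ (Φ i₀).1 := by
    by_cases hx' : x' ∈ (Φ i₀).1
    · exact ⟨x', hx'⟩
    · exact ⟨(starRingAut : ℂ ≃+* ℂ) • x', ((isCMTypeWith_conj (Φ i₀)).rho_smul_mem_iff x').2 hx'⟩
  have hρx₁ : (starRingAut : ℂ ≃+* ℂ) • x₁ ∉ (Φ i₀).1 := ((isCMTypeWith_conj (Φ i₀)).mem_iff x₁).1 hx₁
  have hne : (starRingAut : ℂ ≃+* ℂ) • x₁ ≠ x₁ := (isCMTypeWith_conj (Φ i₀)).rho_smul_ne x₁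
  have hcard : Fintype.card (K i₀ →+* ℂ) = 2 := by rw [Embeddings.card, h2]
  have huniv : (Finset.univ : Finset (K i₀ →+* ℂ)) = {x₁, (starRingAut : ℂ ≃+* ℂ) • x₁} := by
    symm
    apply Finset.eq_univ_of_card
    rw [Finset.card_pair hne.symm, hcard]
  have hall : ∀ x : K i₀ →+* ℂ, x = x₁ ∨ x = (starRingAut : ℂ ≃+* ℂ) • x₁ := fun x => by
    have hmem : x ∈ ({x₁, (starRingAut : ℂ ≃+* ℂ) • x₁} : Finset (K i₀ →+* ℂ)) := huniv ▸ Finset.mem_univ _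
    simpa only [Finset.mem_insert, Finset.mem_singleton] using hmem
  -- the multiplicities ARE constant: `(n(x₁), n(x̄₁))`, with `n(x₁) + n(x̄₁) = ` the common fibre size
  set a := (Finset.univ.filter fun y : K i₁ →+* ℂ => y.comp j = x₁ ∧ y ∈ (Φ i₁).1).card with ha
  set b := (Finset.univ.filter fun y : K i₁ →+* ℂ => y.comp j = (starRingAut : ℂ ≃+* ℂ) • x₁ ∧ y ∈ (Φ i₁).1).card
    with hb
  have hmult : ∀ x : K i₀ →+* ℂ, (Finset.univ.filter fun y : K i₁ →+* ℂ => y.comp j = x ∧ y ∈ (Φ i₁).1).card =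
      if x ∈ (Φ i₀).1 then a else b := fun x => by
    rcases hall x with rfl | rfl
    · rw [if_pos hx₁]
    · rw [if_neg hρx₁]
  have hfib : ∀ x : K i₀ →+* ℂ, (Finset.univ.filter fun y : K i₁ →+* ℂ => y.comp j = x).card = a + b := fun x =>
    card_fibre_restrict_eq j hmult x
  constructor
  · intro hnot x
    have hab : a = b := by
      by_contra hab
      exact hnot ⟨a, b, hab, hmult⟩
    rw [hmult x, hfib x, ← hab]
    split_ifs <;> ring
  · rintro hbal ⟨a', b', hab', hmult'⟩
    have h1 := hbal x₁
    have h2 := hbal ((starRingAut : ℂ ≃+* ℂ) • x₁)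
    rw [hmult' x₁, if_pos hx₁, card_fibre_restrict_eq j hmult' x₁] at h1
    rw [hmult' _, if_neg hρx₁, card_fibre_restrict_eq j hmult' _] at h2
    omega

end Supply

end Summit.HodgeConjecture.CorCM

end
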